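import Literature.Geometry.Lorentzian.Hypersurface
import Literature.Geometry.Riemannian.GaussianShrinker
import Literature.Geometry.Riemannian.ColdingMinicozziEntropy
import Mathlib.Geometry.Manifold.SmoothEmbedding
import Mathlib.MeasureTheory.Measure.Hausdorff
import HarnessLib

/-!
# White's local regularity theorem for mean curvature flow, for flows of cross-sections of `S⁴ × ℝ ⊂ ℝ⁶` (single-sheet form)

Topic `Literature/Geometry/Riemannian` (next to `MCFRegularPointDensity.lean`, `HuiskenMonotonicity.lean`,
`ColdingMinicozziEntropy.lean`).  NAMED FACT (statement only, D-0014), wanted by route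
`Summit.SmoothPoincare4.SmoothPoincare4.Theses.CylinderEntropy`, crux `CylinderRungTwo` (stmt-SmoothPoincare4-7631), line
`killing-flux` (registered stub `stub_whiteRegularitySheet`, of which this is the inlined form: the glue is
`Summits/SmoothPoincare4/SmoothPoincare4/Theorems/CylinderEntropyCylinderRungTwoWhiteSheetOfFact.lean`) and, through the landed
`…EpsilonRegularityOfWhite.lean`, the only unproved input of path A of that line besides Allard's compactness theorem and the
finite-time half.

Source: B. White, *A local regularity theorem for mean curvature flow*, Ann. of Math. (2) 161 (2005), 1487–1519:
Theorem 3.1 (for smooth — indeed for limits of smooth — proper mean curvature flows `𝓜` in an open subset `U` of space-time: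
there are `ε = ε(N) > 0` and `C = C(N) < ∞` such that Gaussian density ratios `Θ(𝓜, X, r) ≤ 1 + ε` for all `X ∈ U` and
`0 < r < d(X, U)` imply `K_{2,α}(𝓜; X) · d(X, U) ≤ C` for all `X ∈ U`, where `K_{2,α}(𝓜; X)` is the smallest `κ` such that the
parabolic dilation of `𝓜 - X` by `κ` is, in the unit parabolic cylinder, the graph of ONE function `u` over a plane with
`‖u‖_{2,α} ≤ 1`) together with §4 ibid. (the same for flows whose normal velocity differs from the mean curvature by a bounded
term, in particular — via the isometric embedding — mean curvature flow in a Riemannian manifold; here the manifold is the round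
cylinder `N = S⁴ × ℝ`, isometrically embedded in `ℝ⁶` with second fundamental form of norm `≤ 1`, so the forcing term
`-tr_{M_t} II_N` has norm `≤ 4`).

## The rendering (single-sheet form, for smooth cylinder flows; WEAKER than the source)

Inputs (all in tree vocabulary, no flow structure): a one-parameter family `F : ℝ → M → ℝ⁶` of maps of a closed connected
`4`-manifold, jointly `C^∞` on an open set `⊇ [T, ∞) × M`, such that each `F t` (`t ≥ T`) is a smooth embedding into
`N = {∑_{i<5} zᵢ² = 1}` and a Euclidean immersion, with a smooth unit normal field `ν t` tangent to `N`, moving by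
`∂ₜ F = -H ν` (`H` the tree's scalar `meanCurvature` of `(F t, ν t)` in `ℝ⁶`, which IS the mean curvature of `M_t ⊂ N` since
`ν ⊥ n_N`) — i.e. exactly the fields of the line's `IsCylinderMCF`.  Hypothesis of the theorem: for a scale `0 < d ≤ d₀` and a
time `t ≥ T + d²`, the EUCLIDEAN Gaussian density ratios `Θ((y,s), r) = gaussianArea 4 y (r²) (range (F (s - r²)))`
(`ColdingMinicozziEntropy.lean`: `(4π r²)⁻² ∫ e^{-‖z-y‖²/4r²} dμHE⁴`, `= 1` on a `4`-plane through `y`) are `≤ 1 + ε` for ALL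
`y ∈ ℝ⁶`, all `s ≤ t + d²` and all `r > 0` with `t - d² ≤ s - r²` — these are MORE pairs `(X', r)` than White's
`X' ∈ U := ℝ⁶ × (t - d², t + d²)`, `r < d(X', U)`.  Conclusion at `X = (F t x, t)` (`d(X, U) = d`), read off from
`K_{2,α}(𝓜; X) ≤ C/d` through the definition of `K_{2,α}` (ONE graph of controlled `C²`-size at scale `d/C` around every
point): (a') the Gauss map `x ↦ ν t x` is `(C/d)`-Lipschitz for the CHORDAL distance at scale `c₁ d` — on one graph the normal
`2`-plane field of `M_t ⊂ ℝ⁶` is Lipschitz, it contains the `1`-Lipschitz radial field `n_N = (z', 0)`, and `ν = ± J n_N` in it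
with the sign fixed by continuity; (b') the lower area bound `c r⁴ ≤ μH⁴(M_t ∩ B(F t x, r))` for `0 < r ≤ c₁ d` (the graph over
the `r/2`-disc lies in the ball and projects onto the disc; Mathlib's un-normalised `μH[4]` dominates Lebesgue measure on
`4`-discs).  The constants `ε, C, c, c₁, d₀ > 0` depend only on the dimension and on `N` (the dependence on the forcing
bound `4` is absorbed in `d₀`).  Dropped from the source (hence weaker): general dimension/codimension/ambient, Brakke and
limit flows, the `C^{2,α}` (indeed `C^∞`, Thm. 3.4) estimates themselves, the interior (non-top-time) points of `U`.
Non-vacuity of the density hypothesis as typed is PROVED in the tree (static slice flow, small scales: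
`densityHypothesis_staticSlice` in `…EpsilonRegularityOfWhite.lean`, via `SphericalCylinderInclusionDomination.lean`).
-- TODO(general form): White's Theorem 3.1/3.5 + §4 for (limits of) smooth `m`-dimensional mean curvature flows with bounded
-- additional forces in open subsets of `ℝⁿ × ℝ`, with the `K_{2,α}` conclusion.

## References

* [White2005] B. White, *A local regularity theorem for mean curvature flow*, Ann. of Math. (2) 161 (2005), 1487–1519,
  Thm. 3.1, Thm. 3.5, §4.
* K. Ecker, *Regularity Theory for Mean Curvature Flow*, Birkhäuser 2004, Thm. 5.6 (exposition).
-/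

noncomputable section

open MeasureTheory Set Filter
open scoped Manifold ContDiff ENNReal NNReal Topology BigOperators

namespace Literature.Geometry.Riemannian

open Literature.Geometry.Lorentzian Literature.Geometry.Lorentzian.PseudoRiemannianMetric

/-- **White 2005, Thm. 3.1 with §4 — local regularity of mean curvature flow, single-sheet form, for smooth flows of closed
cross-sections of `N = S⁴ × ℝ ⊂ ℝ⁶`** (NAMED FACT, statement only, D-0014).  There are `ε, C, c, c₁, d₀ > 0` (depending only
on the dimension `4` and on `N`) such that: for every closed connected `4`-manifold `M`, every family `F : ℝ → M → ℝ⁶`, jointly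
smooth on an open set `⊇ [T, ∞) × M`, of smooth embeddings `F t` (`t ≥ T`) into `N` that are Euclidean immersions, with smooth
unit normals `ν t` tangent to `N`, evolving by mean curvature flow in `N` (`∂ₜF = -H ν`, `H` the scalar mean curvature of
`(F t, ν t)` in `ℝ⁶`), every scale `0 < d ≤ d₀` and time `t` with `T + d² ≤ t`: IF the Euclidean Gaussian density ratios
`gaussianArea 4 y (r²) (range (F (s - r²)))` are `≤ 1 + ε` for all centres `y ∈ ℝ⁶`, all `s ≤ t + d²` and all radii `r > 0`
with `t - d² ≤ s - r²`, THEN at time `t` (a') `‖ν t x - ν t y‖ ≤ (C/d) ‖F t x - F t y‖` whenever `‖F t x - F t y‖ ≤ c₁ d`, and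
(b') `c r⁴ ≤ μH⁴(range (F t) ∩ B(F t x, r))` for `0 < r ≤ c₁ d`.  (White's `K_{2,α}(𝓜; X) d(X, U) ≤ C` for
`U = ℝ⁶ × (t - d², t + d²)`, `X = (F t x, t)`, read through the definition of the one-graph norm `K_{2,α}`, for the forced flow
in `ℝ⁶` of §4.)  Weaker than the source; see the module docstring. [cite: White2005, Thm. 3.1 and §4] -/
def White2005_localRegularity_cylinderFlowSheet : Prop :=
  ∃ ε : ℝ, 0 < ε ∧ ∃ C : ℝ, 0 < C ∧ ∃ c : ℝ, 0 < c ∧ ∃ c₁ : ℝ, 0 < c₁ ∧ ∃ d₀ : ℝ, 0 < d₀ ∧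
    ∀ (M : Type) [TopologicalSpace M] [T2Space M] [SecondCountableTopology M]
      [ChartedSpace (EuclideanSpace ℝ (Fin 4)) M] [IsManifold (𝓡 4) ∞ M] [CompactSpace M] [ConnectedSpace M]
      (F : ℝ → M → EuclideanSpace ℝ (Fin 6)) (ν : ℝ → M → EuclideanSpace ℝ (Fin 6)) (T : ℝ),
      (∃ U : Set ℝ, IsOpen U ∧ Set.Ici T ⊆ U ∧
        ContMDiffOn (𝓘(ℝ, ℝ).prod (𝓡 4)) (𝓡 6) ∞ (fun p : ℝ × M => F p.1 p.2) (U ×ˢ Set.univ)) →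
      (∀ t, T ≤ t → Manifold.IsSmoothEmbedding (𝓡 4) (𝓡 6) ∞ (F t)) →
      (∀ t, T ≤ t → ∀ x, ∑ i : Fin 5, F t x (Fin.castSucc i) ^ 2 = 1) →
      ∀ himm : ∀ t, T ≤ t → (euclideanMetric (EuclideanSpace ℝ (Fin 6))).IsSpacelikeImmersion (𝓡 4) (F t),
      (∀ t, T ≤ t → (euclideanMetric (EuclideanSpace ℝ (Fin 6))).IsUnitNormal (𝓡 4) (F t) (ν t) 1) →
      (∀ t, T ≤ t → ∀ x, ∑ i : Fin 5, ν t x (Fin.castSucc i) * F t x (Fin.castSucc i) = 0) →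
      (∀ t, T ≤ t → ContMDiff (𝓡 4) (𝓡 6) ∞ (ν t)) →
      (∀ t (ht : T ≤ t) (x : M), mfderiv 𝓘(ℝ, ℝ) (𝓡 6) (fun s => F s x) t (1 : ℝ) =
        -((euclideanMetric (EuclideanSpace ℝ (Fin 6))).meanCurvature (F t) contMDiff_pullbackBilin_holds
            (himm t ht) (ν t) x) • ν t x) →
      ∀ t d : ℝ, 0 < d → d ≤ d₀ → T + d ^ 2 ≤ t →
      (∀ (y : EuclideanSpace ℝ (Fin 6)) (s r : ℝ), 0 < r → t - d ^ 2 ≤ s - r ^ 2 → s ≤ t + d ^ 2 →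
        gaussianArea 4 y (r ^ 2) (Set.range (F (s - r ^ 2))) ≤ ENNReal.ofReal (1 + ε)) →
      (∀ x y : M, ‖F t x - F t y‖ ≤ c₁ * d → ‖ν t x - ν t y‖ ≤ C / d * ‖F t x - F t y‖) ∧
      (∀ x : M, ∀ r : ℝ, 0 < r → r ≤ c₁ * d →
        ENNReal.ofReal (c * r ^ 4) ≤ μH[4] (Set.range (F t) ∩ Metric.ball (F t x) r))

end Literature.Geometry.Riemannian

end
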